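import Summits.HodgeConjecture.HodgeConjecture.Theorems.F0P6aModuliDatumDefsTuples   -- ★ previous part of the same Lines workfile `F0_P6a_ModuliDatumDefs` (size-lint split ×4)
import HarnessLib

/-!
# `F0P6aModuliDatumDefsDatum` — ★ RE-HOME of `Lines/F0_P6a_ModuliDatumDefs.lean`, PART 3 of 4 (size-lint split; cut at a declaration boundary).

See PART 1 `Theorems/F0P6aModuliDatumDefsReadings.lean` for the full re-home header and the original module docstring (verbatim there). Namespaces and sections KEPT
(re-opened below exactly as they stand at the cut, with their `open`∕`variable` lines replayed); code bytes = the workfile՚s, docstrings included; options preamble repeated from PART 1.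
HC_CM is proved only modulo the 7 printed citations (2 remaining: hLiu418 = stmt-HodgeConjecture-24832, h413 = stmt-HodgeConjecture-24833) until rung 0 closes; a re-home is count-neutral. -/

namespace Summit.HodgeConjecture.HodgeConjecture.Cruxes.HLiu418.F0P6aModuliDatumDefs
set_option linter.dupNamespace false  -- `Summit.HodgeConjecture.HodgeConjecture.…` BY DESIGN (D-0017)
open CategoryTheory NumberField IsDedekindDomain MulAction
open scoped Matrix
open Literature.NumberTheory.GaloisRepresentations
open Literature.NumberTheory.Automorphic Literature.NumberTheory.Automorphic.UnitaryGroup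
open Literature.AlgebraicGeometry.ShimuraVarieties.UnitaryCanonicalModel
open Literature.NumberTheory.Automorphic.Liu2021.AppendixC
open Literature.AlgebraicGeometry.Motives (AlgPoints IntegralModel frobeniusOver SchemeOver thickening thickeningGalAction thickeningLift)
open Literature.NumberTheory.DiophantineGeometry (geomResidueField specialFibreFunctor)
open Literature.AlgebraicGeometry.RelativeSpec (ActionOver)
open Literature.NumberTheory.EllipticCurves (genericFibre)
open AlgebraicGeometry (QuasiCompact QuasiSeparated LocallyOfFinitePresentation Flat IsSeparated SmoothOfRelativeDimension)
open Summit.HodgeConjecture.HodgeConjecture.Cruxes.HLiu418.F0P6cIsogenyDictionary (PointDictionary)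
open scoped Pointwise
open scoped MonoidalCategory Polynomial
open Literature.AlgebraicGeometry.Motives (specOver relFrobeniusOver frobeniusTwistOver frobSpec)
open Literature.AlgebraicGeometry.GroupSchemes.AffineGroupScheme (Alg quotIncl)
open Summit.HodgeConjecture.HodgeConjecture.Cruxes.HLiu418.F0P6cDictConstructors (kerFI AdmSub IdealIsEtale)


/-! ### §2 The moduli datum (layer (i): READING ∕ DICT data + TWIST transport; layer (ii) (desks g0 v0.3 + g1 v0.4–v0.5): D1 universal tuple `univ∕act∕dual∕pol`, D-1 LEVEL `g N lvl`, `inj₀`, twist data `twistIdeal∕twistNorm`, `pChar∕hpChar∕fDeg∕charP₀`, (R-1) `block₀`, (R-2) `frob₀`; guards `hunit`∕`hKc`∕`hdisj` threaded into both ∀-letters (F0P5a-ref1 (s3)); TOKEN = DROP (M-17r): every field is read by a letter, a constructor, the HFROB derivation row or another field՚s type) -/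

/-! ### §1⁗ LAYER (ii) (R-1)∕(R-2) helpers (desk g1, v0.5; LEAD M-17j (2), ref1 (g2) J10 «LETTER SUFFICIENCY»): the SPECIAL-fibre tuple at `x̄` as an abelian SCHEME over
`Spec κ̄(w)` (dual pair, polarisation, level points), the DOWNSTAIRS ISOGENY ROOF carrying the FROBENIUS-KERNEL LAW (★ σ2-CORE `hker` shape), and the FROBENIUS COVER reading
the reduction of `σ • y` against the Frobenius twist of the reduction of `y` -/

/-- (R) helper: the special fibre at `x̄ ∈ 𝓨_s(κ̄(w))` as an abelian SCHEME over `Spec κ̄(w)` — the ITERATED base change `(𝒜 ×_𝓨 𝓨_s) ×_{𝓨_s} Spec κ̄` along `ι_s = pr₁` then `x̄`, so that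
`fibre₀Of 𝓜 w 𝒜 x̄ = (sch₀Of 𝓜 w 𝒜 x̄).toAffine.toAbelianVariety` ON THE NOSE (★ `fibre`); the special twin of `schΩOf`, the carrier of ★ `DualPair.baseChange`, ★ `Polarization.baseChange`,
★ `dualIsogenyOver`, ★ `mulN`, ★ `relFrobeniusOver` downstairs. [cite: MumfordFogartyKirwan1994, Ch. 6 §1 (p. 115)] -/
noncomputable abbrev sch₀Of {F : Type} [Field F] [NumberField F] {X : SchemeOver F}
    (𝓜 : IntegralModel (𝓞 F) F X) (w : HeightOneSpectrum (𝓞 F))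
    (𝒜 : Literature.AlgebraicGeometry.AbelianSchemes.AbelianSchemeOver (𝓜.localise w).total.left)
    (xbar : AlgPoints (𝓜.localise w).reductionAt (geomResidueField w)) :
    Literature.AlgebraicGeometry.AbelianSchemes.AbelianSchemeOver (AlgebraicGeometry.Spec (CommRingCat.of (geomResidueField w))) :=
  (𝒜.baseChange
      (CategoryTheory.Limits.pullback.fst (𝓜.localise w).total.hom (Literature.NumberTheory.DiophantineGeometry.specResidueField w))).baseChange
    xbar.left

/-- (R) helper: the dual pair `(Â_x̄, 𝒫_x̄)` of the special fibre at `x̄` (★ `DualPair.baseChange`, twice). [cite: MumfordFogartyKirwan1994, Ch. 6 §1 (p. 115)] -/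
noncomputable abbrev dual₀Of {F : Type} [Field F] [NumberField F] {X : SchemeOver F}
    (𝓜 : IntegralModel (𝓞 F) F X) (w : HeightOneSpectrum (𝓞 F))
    (𝒜 : Literature.AlgebraicGeometry.AbelianSchemes.AbelianSchemeOver (𝓜.localise w).total.left)
    (D : 𝒜.DualPair) (xbar : AlgPoints (𝓜.localise w).reductionAt (geomResidueField w)) : (sch₀Of 𝓜 w 𝒜 xbar).DualPair :=
  (D.baseChange
      (CategoryTheory.Limits.pullback.fst (𝓜.localise w).total.hom (Literature.NumberTheory.DiophantineGeometry.specResidueField w))).baseChange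
    xbar.left

/-- (R) helper: the polarisation `λ_x̄ : A_x̄ → Â_x̄` of the special fibre at `x̄` (★ `Polarization.baseChange`, twice; EXACT, no scalar). [cite: MumfordFogartyKirwan1994, Ch. 6 §2 Definition 6.3 (p. 120)] -/
noncomputable abbrev pol₀Of {F : Type} [Field F] [NumberField F] {X : SchemeOver F}
    (𝓜 : IntegralModel (𝓞 F) F X) (w : HeightOneSpectrum (𝓞 F))
    (𝒜 : Literature.AlgebraicGeometry.AbelianSchemes.AbelianSchemeOver (𝓜.localise w).total.left)
    {D : 𝒜.DualPair} (pol : 𝒜.Polarization D) (xbar : AlgPoints (𝓜.localise w).reductionAt (geomResidueField w)) :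
    (sch₀Of 𝓜 w 𝒜 xbar).Polarization (dual₀Of 𝓜 w 𝒜 D xbar) :=
  (pol.baseChange
      (CategoryTheory.Limits.pullback.fst (𝓜.localise w).total.hom (Literature.NumberTheory.DiophantineGeometry.specResidueField w))).baseChange
    xbar.left

/-- (R) helper: the level point `σ^a(x̄) ∈ A_x̄(κ̄(w))` of a level-`N` structure, read on the special fibre at `x̄` (★ `LevelStructure.baseChange`, ★ `section_`, ★ `restrictPt`; the
special twin of `lvlPtΩOf`). [cite: MumfordFogartyKirwan1994, Ch. 7 §2 Definition 7.1 (p. 129)] -/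
noncomputable def lvlPt₀Of {F : Type} [Field F] [NumberField F] {X : SchemeOver F}
    (𝓜 : IntegralModel (𝓞 F) F X) (w : HeightOneSpectrum (𝓞 F))
    (𝒜 : Literature.AlgebraicGeometry.AbelianSchemes.AbelianSchemeOver (𝓜.localise w).total.left)
    {g N : ℕ} (lvl : 𝒜.LevelStructure g N) (xbar : AlgPoints (𝓜.localise w).reductionAt (geomResidueField w)) (a : Fin g ⊕ Fin g → ZMod N) :
    (fibre₀Of 𝓜 w 𝒜 xbar).Points (geomResidueField w) :=
  (𝒜.baseChange
      (CategoryTheory.Limits.pullback.fst (𝓜.localise w).total.hom (Literature.NumberTheory.DiophantineGeometry.specResidueField w))).restrictPt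
    xbar.left
    ((lvl.baseChange
      (CategoryTheory.Limits.pullback.fst (𝓜.localise w).total.hom (Literature.NumberTheory.DiophantineGeometry.specResidueField w))).section_ a)

set_option maxHeartbeats 400000 in
open scoped MonObj Obj in
/-- (R-2) helper — **THE DOWNSTAIRS ISOGENY ROOF `A_x̄ —q̄→ B̄ ←c̄— A_x̄″` CARRYING THE FROBENIUS-KERNEL LAW** (LEAD M-17j (2) «(R-2) belongs IN ED. 3»; ref1 (g2) J10; the `κ̄(w)`-twin of
`RoofΩ` with SCHEME-THEORETIC kernels — functor of points `∀ T (t : T → _)`, as the non-étale kernels demand): for a tuple `(𝒜, ι, (Â, 𝒫), λ, level-N)` over `𝓨`, two special points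
`x̄, x̄″`, a prime `p` with `q = p^f`, and ideals `𝔭` (the cover ideal) and `𝔠` (the Frobenius co-ideal): an abelian scheme `B̄ ∕ κ̄` with a dual pair and `λ_B̄ : B̄ → B̄^`, and
HOMOMORPHISMS `q̄ : A_x̄ → B̄`, `c̄ : A_x̄″ → B̄` with (r1₀) `q̄` an fppf epimorphism (flat, surjective — an isogeny; its kernel is pinned by (rL)); (r2₀) `Ker c̄ = A_x̄″[𝔭]` ON `T`-POINTS
(`t ≫ c̄ = 1 ↔ ∀ a ∈ 𝔭, t ≫ ι(a) = 1`) and `c̄` surjective — so `A_x̄″ ≅ B̄ ⊗_𝒪 𝔭` (SERRE; ★ `SerreTensorIntegralIdealCover`); (r3₀) `q̄^*λ_B̄ = p·λ_x̄`, `c̄^*λ_B̄ = p·λ_x̄″` EXACT (★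
`dualIsogenyOver`, ★ `mulN`); (r4₀) `𝒪_F`-equivariance through a common endomorphism of `B̄`; (r5₀) level points correspond; and **(rL) THE FROBENIUS-KERNEL LAW
`Ker F_{A_x̄∕κ̄,q} = q̄⁻¹(B̄[𝔠])` ON `T`-POINTS: `t ≫ F_q = 1 ↔ ∀ a ∈ 𝔠, t ≫ ι(a) ≫ q̄ = 1`** — VERBATIM the hypothesis `hker` of ★ (σ2-CORE)
`exists_iso_relFrobeniusHom_comp_comp_serreTranslate_eq` (p846334; «INPUTS LEFT TO THE CONSUMER: the block computation `hker` … + `ModuliDatum`»), with `F_q =` ★ `relFrobeniusOver p f`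
(`= relFrobeniusHom`, by `rfl`).  BLOCK READING of (rL) (`𝔭 = 𝔭_w`, `𝔠 = 𝔭_w^{d_w−1}·𝔟 = 𝔞_γ𝔭_w⁻¹`, `Ker q̄ = sp(H_L) ⊕ sp(N) ⊕ 0`): on the `c•w`-block `𝔠` is a unit, so `Ker F ∩ 𝒢 = Ker q̄ ∩ 𝒢 = sp(H_L)`
— the hypothesis `sp L = ker F` of HEART-FROB′; on the `w`-block `Ker F ∩ A[w^∞] = [ϖ_w^{d_w−1}]⁻¹ sp(N)` (orders `q^{2d_w−1}` on both sides: `A[w^∞] ≅ 𝒢^D` has height `2d_w`, dimension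
`2d_w − 1`); on the banal blocks `Ker F ∩ A[u^∞] = A[𝔟_u]` (Shimura–Taniyama) — ref1՚s three kernel laws (R-2) AT ONCE, pairing-free and `sp`-currency-free.  The congruence relation
in print: [Liu2021] Prop. D.8 (3) proof pp. 136–138; [Wedhorn2000]; Kottwitz §5; RSZ (4.23).  NOT asserted by declaring it.  (N-split, Defs ED. 3 collector; LEAD
21:47:49Z (B), A-p14 (g33)): under `[IsGalois ℚ F]` NO place `u ∣ p(w)` is non-split once `w` is split (`c` central, `Gal(F∕ℚ)` transitive on the places over `p`) —
★ `Literature.NumberTheory.NumberFields.CMFieldGaloisPrimesOverSplit` (`complexConj_smul_ne_of_natCast_mem`, `complexConj_smul_eq_iff_of_natCast_mem`; p844445) BY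
NAME — so the banal-block clause of (rL) needs only the étale + multiplicative block laws (★ `GroupSchemes/EtaleOfCotangentRankZero` p846848, ★
`AbelianSchemes/TorsionBlockEtaleOfLieSignature` p846872, ★ `GroupSchemes/CartierDualBlockDuality` p846891).
[cite: Liu2021, Prop. D.8 (3) p. 135, pp. 136–138] [cite: RapoportSmithlingZhang2020Diagonal, §4.3 (4.23) p. 21] [cite: MumfordAV1970, §23 Thm. 2 p. 231; §15 Thm. 1 p. 143]
[cite: Shimura1998, §13.1 Thm. 1 (pp. 97–99)] [cite: Kottwitz1992, §5, p. 391] -/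
def Roof₀ {F : Type} [Field F] [NumberField F] {X : SchemeOver F}
    (𝓜 : IntegralModel (𝓞 F) F X) (w : HeightOneSpectrum (𝓞 F))
    (𝒜 : Literature.AlgebraicGeometry.AbelianSchemes.AbelianSchemeOver (𝓜.localise w).total.left)
    (ρ : Literature.AlgebraicGeometry.AbelianSchemes.AbelianSchemeOver.RingAction (𝓞 F) 𝒜)
    (D : 𝒜.DualPair) (pol : 𝒜.Polarization D) {g N : ℕ} (lvl : 𝒜.LevelStructure g N)
    (pChar fDeg : ℕ) [ExpChar (geomResidueField w) pChar] (𝔭 𝔠 : Ideal (𝓞 F))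
    (xbar xbar'' : AlgPoints (𝓜.localise w).reductionAt (geomResidueField w)) : Prop :=
  ∃ (B : Literature.AlgebraicGeometry.AbelianSchemes.AbelianSchemeOver (AlgebraicGeometry.Spec (CommRingCat.of (geomResidueField w))))
    (DB : B.DualPair) (lamB : B.X ⟶ DB.hat.X) (_ : IsMonHom lamB)
    -- J12 INTERFACE PIN (ref1 (g2) e-12): `B̂`'s Poincaré sheaf is normalised along `A × {ε_B̂}` — the unit clause `hD_B` (for a ★ `Polarization` it is ★ `Polarization.nonempty_unitHatSlice_iso`)
    (_ : Nonempty ((AlgebraicGeometry.Scheme.Modules.pullback DB.unitHatSlice).obj DB.P ≅ SheafOfModules.unit _))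
    (q : (sch₀Of 𝓜 w 𝒜 xbar).X ⟶ B.X) (_ : IsMonHom q)
    (c : (sch₀Of 𝓜 w 𝒜 xbar'').X ⟶ B.X) (_ : IsMonHom c),
    -- (r1₀) `q̄` is an isogeny (fppf epimorphism); its kernel is pinned by (rL)
    AlgebraicGeometry.Flat q.left ∧ Function.Surjective q.left.base ∧
    -- (r2₀) kernel of `c̄` = the `𝔭`-torsion SCHEME-THEORETICALLY; `c̄` surjective
    (∀ ⦃T : SchemeOver (geomResidueField w)⦄ (t : T ⟶ (sch₀Of 𝓜 w 𝒜 xbar'').X),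
        t ≫ c = 1 ↔ ∀ a ∈ 𝔭, t ≫ (act₀Of 𝓜 w 𝒜 ρ a xbar'').hom.hom.hom = 1) ∧
    Function.Surjective c.left.base ∧
    -- (r3₀) polarisations: `q̄^* λ_B̄ = p • λ_x̄`, `c̄^* λ_B̄ = p • λ_x̄″`
    q ≫ lamB ≫ Literature.AlgebraicGeometry.AbelianSchemes.AbelianSchemeOver.DualPair.dualIsogenyOver q (dual₀Of 𝓜 w 𝒜 D xbar) DB =
      (pol₀Of 𝓜 w 𝒜 pol xbar).lam ≫ (dual₀Of 𝓜 w 𝒜 D xbar).hat.mulN pChar ∧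
    c ≫ lamB ≫ Literature.AlgebraicGeometry.AbelianSchemes.AbelianSchemeOver.DualPair.dualIsogenyOver c (dual₀Of 𝓜 w 𝒜 D xbar'') DB =
      (pol₀Of 𝓜 w 𝒜 pol xbar'').lam ≫ (dual₀Of 𝓜 w 𝒜 D xbar'').hat.mulN pChar ∧
    -- (r4₀) `𝒪_F`-equivariance through a common endomorphism of `B̄`
    (∀ a : 𝓞 F, ∃ b : B.X ⟶ B.X,
        (act₀Of 𝓜 w 𝒜 ρ a xbar).hom.hom.hom ≫ q = q ≫ b ∧ (act₀Of 𝓜 w 𝒜 ρ a xbar'').hom.hom.hom ≫ c = c ≫ b) ∧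
    -- (r5₀) level-`N` points correspond
    (∀ a : Fin g ⊕ Fin g → ZMod N,
        (AlgPoints.map q (lvlPt₀Of 𝓜 w 𝒜 lvl xbar a) : B.toAffine.toAbelianVariety.Points (geomResidueField w)) =
          AlgPoints.map c (lvlPt₀Of 𝓜 w 𝒜 lvl xbar'' a)) ∧
    -- (rL) THE FROBENIUS-KERNEL LAW `Ker F_q = q̄⁻¹(B̄[𝔠])` on `T`-points (★ σ2-CORE `hker` verbatim)
    (∀ ⦃T : SchemeOver (geomResidueField w)⦄ (t : T ⟶ (sch₀Of 𝓜 w 𝒜 xbar).X),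
        t ≫ relFrobeniusOver pChar fDeg (sch₀Of 𝓜 w 𝒜 xbar).X =
            (1 : T ⟶ ((sch₀Of 𝓜 w 𝒜 xbar).baseChange (frobSpec (geomResidueField w) pChar fDeg)).X) ↔
          ∀ a ∈ 𝔠, t ≫ (act₀Of 𝓜 w 𝒜 ρ a xbar).hom.hom.hom ≫ q = 1)

set_option maxHeartbeats 400000 in
open scoped MonObj Obj in
/-- (R-2) helper — **THE FROBENIUS COVER `c̄ : A_{x̄′} → A_x̄^{(q)}` READING `𝒯₀(x̄′) ≅ 𝒯₀(x̄)^{(q)} ⊗_{𝒪_F} 𝔞`, EXACTLY** (the `κ̄(w)`-twin of `CoverΩ` against the Frobenius twist `A_x̄^{(q)} :=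
A_x̄ ×_{κ̄, Frob^f} κ̄` — ★ `AbelianSchemeOver.baseChange` along ★ `frobSpec`, whose carrier is ★ `frobeniusTwistOver p f A_x̄.X` by `rfl`; `F_q =` ★ `relFrobeniusOver p f`): a HOMOMORPHISM `c̄`
with (f1) the SERRE PRESENTATION of `𝔞` («`c̄ ≫ d_a = ι′(a)`, `d_a ≫ c̄ = ι^{(q)}(a)`» for `a ∈ 𝔞`; `ι^{(q)}(a) =` ★ `baseChangeHom ι(a) Frob^f`); (f1′) [Defs ED. 2] the KERNEL CLAUSE «`Ker c̄ = A_{x̄′}[𝔞]`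
SCHEME-THEORETICALLY on all `T`-points» + `c̄` surjective — the special twin of `Roof₀` (r2₀), so that the σ2 pen writes `A_x̄^{(q)} ≅ A_{x̄′} ⊗ 𝔞⁻¹` UNDER `A_{x̄′}` in one line by
★ KER-EQ (`exists_iso_serreTranslate_comp_eq_of_comp_eq_one_iff_forall_mem`), rank-free, no `deg λ` transport (A-p13 (g36) 20:51:00Z; LEAD 20:53:43Z (2)); the ED.-1 clause (f2)
«upper bound through `𝔞̄` and `(n) = 𝔞𝔞̄`» is DROPPED at ED. 2 (unread once (f1′) pins the kernel — M-17r TOKEN = DROP; truth for the witness unchanged: the generic cover is ★ `serreTranslateInv`,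
kernel law ★ `SerreTensorIntegralIdealCoverKernel.comp_serreTranslateInv_eq_one_iff_forall_comp_serreAction_i_eq_one`, and reduction preserves scheme kernels of finite flat homs, as for (r2₀));
(f3) `c̄^*λ^{(q)} = n·λ′` EXACT (`λ^{(q)} =` ★ `Polarization.baseChange` along `Frob^f`; ★ `dualIsogenyOver`, ★ `mulN`); (f4) `𝒪_F`-equivariance; (f5) level: `c̄(σ^a(x̄′)) = F_q(σ^a(x̄))`
(the level points of the twist ARE the Frobenius images, ★ `restrictPt` along `Frob`).  Used with `x̄′ = red₀(σ • y)`, `x̄ = red₀ y`, `𝔞 = 𝔞_{γ_σ}`, `n = n_{γ_σ} = q`: «the reduction of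
`σ • y` on the sheet `e` is the `𝔞_{γ_σ}`-cover of the Frobenius twist of the reduction of `y`» — the reduction of the generic Serre cover (helper `CoverΩ` at `(γ_σ, σ • y)`, GEN-side) along the two integral
points (`ℓ_{e∘γ_σ}(σ•y) = σ(ℓ_e y)`) composed with «reduction of the `σ`-conjugate = Frobenius twist of the reduction» (★ `AbelianVarietyConjFrobTwistedReductionMap` lineage).
With the π₀-free σ2 spine (★ `SerreTranslateComposition` §2: `e′ : A^{(q)} ≅ B ⊗ 𝔞⁻¹`) it yields `A_{red₀(σ•y)} ≅ A_{red₀(quotΩ y L)}` as EXACT tuples.  NOT asserted by declaring it.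
[cite: Shimura1998, §13.1 Thm. 1 (pp. 97–99); §18.6 proof of Thm. 18.6, p. 127] [cite: SerreTate1968, Thm 1, Cor. 2] [cite: RapoportSmithlingZhang2020Diagonal, §3.2 p. 11, §4.3 p. 20]
[cite: MumfordAV1970, §15 Thm. 1 p. 143] -/
def FrobCover₀ {F : Type} [Field F] [NumberField F] [IsCMField F] {X : SchemeOver F}
    (𝓜 : IntegralModel (𝓞 F) F X) (w : HeightOneSpectrum (𝓞 F))
    (𝒜 : Literature.AlgebraicGeometry.AbelianSchemes.AbelianSchemeOver (𝓜.localise w).total.left)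
    (ρ : Literature.AlgebraicGeometry.AbelianSchemes.AbelianSchemeOver.RingAction (𝓞 F) 𝒜)
    (D : 𝒜.DualPair) (pol : 𝒜.Polarization D) {g N : ℕ} (lvl : 𝒜.LevelStructure g N)
    (pChar fDeg : ℕ) [ExpChar (geomResidueField w) pChar] (𝔞 : Ideal (𝓞 F)) (n : ℕ)
    (xbar' xbar : AlgPoints (𝓜.localise w).reductionAt (geomResidueField w)) : Prop :=
  ∃ (c : (sch₀Of 𝓜 w 𝒜 xbar').X ⟶ ((sch₀Of 𝓜 w 𝒜 xbar).baseChange (frobSpec (geomResidueField w) pChar fDeg)).X) (_ : IsMonHom c),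
    -- (f1) Serre presentation of `𝔞`
    (∀ a ∈ 𝔞, ∃ d : ((sch₀Of 𝓜 w 𝒜 xbar).baseChange (frobSpec (geomResidueField w) pChar fDeg)).X ⟶ (sch₀Of 𝓜 w 𝒜 xbar').X,
        c ≫ d = (act₀Of 𝓜 w 𝒜 ρ a xbar').hom.hom.hom ∧
        d ≫ c = Literature.AlgebraicGeometry.AbelianSchemes.AbelianSchemeOver.baseChangeHom (A := sch₀Of 𝓜 w 𝒜 xbar) (B := sch₀Of 𝓜 w 𝒜 xbar)
          (act₀Of 𝓜 w 𝒜 ρ a xbar).hom.hom.hom (frobSpec (geomResidueField w) pChar fDeg)) ∧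
    -- (f1′) kernel of `c̄` = the `𝔞`-torsion SCHEME-THEORETICALLY, on ALL `T`-points (the special twin of `Roof₀` (r2₀), token-symmetric; Defs ED. 2); `c̄` surjective
    (∀ ⦃T : SchemeOver (geomResidueField w)⦄ (t : T ⟶ (sch₀Of 𝓜 w 𝒜 xbar').X),
        t ≫ c = (1 : T ⟶ ((sch₀Of 𝓜 w 𝒜 xbar).baseChange (frobSpec (geomResidueField w) pChar fDeg)).X) ↔
          ∀ a ∈ 𝔞, t ≫ (act₀Of 𝓜 w 𝒜 ρ a xbar').hom.hom.hom = 1) ∧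
    Function.Surjective c.left.base ∧
    -- (f3) polarisations: `c̄^* λ^{(q)} = n • λ′`
    c ≫ ((pol₀Of 𝓜 w 𝒜 pol xbar).baseChange (frobSpec (geomResidueField w) pChar fDeg)).lam ≫
        Literature.AlgebraicGeometry.AbelianSchemes.AbelianSchemeOver.DualPair.dualIsogenyOver c
          (dual₀Of 𝓜 w 𝒜 D xbar') ((dual₀Of 𝓜 w 𝒜 D xbar).baseChange (frobSpec (geomResidueField w) pChar fDeg)) =
      (pol₀Of 𝓜 w 𝒜 pol xbar').lam ≫ (dual₀Of 𝓜 w 𝒜 D xbar').hat.mulN n ∧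
    -- (f4) `𝒪_F`-equivariance
    (∀ a : 𝓞 F, (act₀Of 𝓜 w 𝒜 ρ a xbar').hom.hom.hom ≫ c =
        c ≫ Literature.AlgebraicGeometry.AbelianSchemes.AbelianSchemeOver.baseChangeHom (A := sch₀Of 𝓜 w 𝒜 xbar) (B := sch₀Of 𝓜 w 𝒜 xbar)
          (act₀Of 𝓜 w 𝒜 ρ a xbar).hom.hom.hom (frobSpec (geomResidueField w) pChar fDeg)) ∧
    -- (f5) level-`N` points: `c̄(σ^a(x̄′)) = F_q(σ^a(x̄))`
    (∀ a : Fin g ⊕ Fin g → ZMod N,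
        (AlgPoints.map c (lvlPt₀Of 𝓜 w 𝒜 lvl xbar' a) :
            AlgPoints ((sch₀Of 𝓜 w 𝒜 xbar).baseChange (frobSpec (geomResidueField w) pChar fDeg)).X (geomResidueField w)) =
          AlgPoints.map (relFrobeniusOver pChar fDeg (sch₀Of 𝓜 w 𝒜 xbar).X :
              (sch₀Of 𝓜 w 𝒜 xbar).X ⟶ ((sch₀Of 𝓜 w 𝒜 xbar).baseChange (frobSpec (geomResidueField w) pChar fDeg)).X)
            (lvlPt₀Of 𝓜 w 𝒜 lvl xbar a))

set_option maxHeartbeats 400000 in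
set_option synthInstance.maxHeartbeats 400000 in  -- the transported group structure on the double Frobenius twist (`hFFU₀`); P6c `heart_of_carriers` uses the same budget
open scoped MonObj Obj in
/-- (R-1) **`BlockReading₀` — THE `heart_of_carriers` SOCKET BLOCK OF THE DATUM, AS DATA** (LEAD M-17j (2) «(R-1) belongs IN ED. 3»; ref1 (g2) J10 «LETTER SUFFICIENCY: a letter
needing a not-yet-typed field is RED»): for the universal tuple `(𝒜, ρ)` of a `ModuliDatum` and its carriers `Line ∕ Sub ∕ kerF ∕ IsEtale ∕ quot ∕ transl ∕ sp` (parameters here,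
fields there), the `κ̄(w)`-level K-DATA and K-HYP binders of P6c `heart_of_carriers` (ED. 2 «HEAD ON GIVEN CARRIERS», 91b03e33) TOKEN FOR TOKEN — the `c•w`-layer carriers `G₀ x̄`
with `𝒪_F`-action `β₀`, PINNED to `A_x̄ := 𝒜_x̄` as the scheme-theoretic kernel of the ideal `𝔭_{c•w}` (`ι₀G`, `hkerG₀`, `hβ₀G` — so no admissible re-choice can flip a letter:
`(G₀, β₀)` is unique up to unique isomorphism), unit components with monogenic coordinates, the four numerics (`hFFU hrkG hrkF hpts`) and `hsimple`, the DOWNSTAIRS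
IDENTIFICATION D-4 (`subEquiv`, `kerF_spec : kerF ↦ kerFI`, `isEtale_spec`), the layer maps of the quotient isogenies (`isogW₀`, hom, kills `H`), D6 in kills-form
(`quot_quot₀`) and the canonical line (b4′) (`canonicalLine₀`).  Packaged as ONE structure-valued field `ModuliDatum.block₀` (like `TwistReadingΩ`: the flat field list
times out the structure elaborator).  At ED. 4 `stub_HEART := heart_of_carriers p f 𝔇.block₀.G₀ 𝔇.block₀.β₀ …` modulo instance plumbing; every field is GEN՚s (`stub_RGD`)
obligation, discharged from the K∕BT chain (★ `pDivisibleGroup`, (O-LOC), (O-J) `CartierDualAnnihilatorFlat` p846454) and P6b `blockNumerics_of_line`.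
[cite: Tate1997FiniteFlatGroupSchemes, (3.7)] [cite: Liu2021, Prop. D.8 p. 135, p. 137] [cite: SGA3I, VII_A 4.1] [cite: Carayol1986Compositio, §10.3 Prop. p. 211] -/
structure BlockReading₀ {F : Type} [Field F] [NumberField F] [IsCMField F] {ι₁ : F →+* ℂ} {Jstar : Matrix (Fin 2) (Fin 2) F}
    {K₀ : C5.OpenCompactSubgroup ↥(finAdelic ↥(maximalRealSubfield F) F (IsCMField.complexConj F) 2 Jstar)}
    (S : RecordSystemGS F Jstar ι₁ K₀) {Fi : Type} [Field Fi] [Algebra F Fi] (Kc : C5.SmallLevel K₀)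
    (𝓜 : IntegralModel (𝓞 F) F ((thickening F Fi).obj (S.M.obj Kc))) (w : HeightOneSpectrum (𝓞 F))
    (h𝓨 : (𝓜.localise w).IsSmoothProper 1) (e : Fi →ₐ[F] AlgebraicClosure (w.adicCompletion F))
    (𝒜 : Literature.AlgebraicGeometry.AbelianSchemes.AbelianSchemeOver (𝓜.localise w).total.left)
    (ρ : Literature.AlgebraicGeometry.AbelianSchemes.AbelianSchemeOver.RingAction (𝓞 F) 𝒜)
    (pChar fDeg : ℕ) [CharP (geomResidueField w) pChar] [ExpChar (geomResidueField w) pChar]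
    (Line : AlgPoints (S.M.obj Kc) (AlgebraicClosure (w.adicCompletion F)) → Type)
    (Sub : AlgPoints (𝓜.localise w).reductionAt (geomResidueField w) → Type) (kerF : ∀ xbar, Sub xbar) (IsEtale : ∀ {xbar}, Sub xbar → Prop)
    (quot : ∀ xbar, Sub xbar → AlgPoints (𝓜.localise w).reductionAt (geomResidueField w))
    (transl : AlgPoints (𝓜.localise w).reductionAt (geomResidueField w) → AlgPoints (𝓜.localise w).reductionAt (geomResidueField w))
    (sp : ∀ y, Line y → Sub (red₀Of S Kc 𝓜 w h𝓨 e y)) where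
  /-- K-DATA — **THE `c•w`-LAYER CARRIERS `G₀ x̄`** («`A_x̄[𝔭_{c•w}] = 𝒢_x̄[ϖ]`», pinned by `ι₀G`∕`hkerG₀`): a `κ̄(w)`-scheme per special point — P6c binder `G₀`. [cite: Tate1997FiniteFlatGroupSchemes, (3.7)] [cite: Liu2021, p. 137] -/
  G₀ : AlgPoints (𝓜.localise w).reductionAt (geomResidueField w) → SchemeOver (geomResidueField w)
  /-- its group-scheme structure (P6c binder `[∀ x, GrpObj (G₀ x)]`). [cite: Tate1997FiniteFlatGroupSchemes, (3.7)] -/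
  grp₀ : ∀ xbar, GrpObj (G₀ xbar)
  /-- commutative (P6c binder `[∀ x, IsCommMonObj (G₀ x)]`). [cite: Tate1997FiniteFlatGroupSchemes, (3.7)] -/
  comm₀ : ∀ xbar, letI := grp₀ xbar; IsCommMonObj (G₀ xbar)
  /-- affine (P6c binder `[∀ x, IsAffine (G₀ x).left]`). [cite: Tate1997FiniteFlatGroupSchemes, (3.7)] -/
  aff₀ : ∀ xbar, AlgebraicGeometry.IsAffine (G₀ xbar).left
  /-- finite over `κ̄(w)` (P6c binder `[∀ x, IsFinite (G₀ x).hom]`). [cite: Tate1997FiniteFlatGroupSchemes, (3.7)] -/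
  fin₀ : ∀ xbar, AlgebraicGeometry.IsFinite (G₀ xbar).hom
  /-- the `𝒪_F`-action on `G₀ x̄` (P6c binder `β₀`; `= ι(a)` restricted, `hβ₀G`). [cite: Kottwitz1992, §5, p. 390] -/
  β₀ : ∀ xbar, 𝓞 F → (G₀ xbar ⟶ G₀ xbar)
  /-- by homomorphisms (P6c binder `hβ₀`). [cite: Kottwitz1992, §5, p. 390] -/
  hβ₀ : ∀ xbar a, letI := grp₀ xbar; IsMonHom (β₀ xbar a)
  /-- PIN — the closed immersion `ι₀G : G₀ x̄ ↪ A_x̄` into the special fibre (a homomorphism). [cite: Tate1997FiniteFlatGroupSchemes, (3.7)] -/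
  ι₀G : ∀ xbar, G₀ xbar ⟶ (sch₀Of 𝓜 w 𝒜 xbar).X
  /-- PIN — `ι₀G` is a homomorphism and a closed immersion. [cite: Tate1997FiniteFlatGroupSchemes, (3.7)] -/
  hι₀G : ∀ xbar, (letI := grp₀ xbar; IsMonHom (ι₀G xbar)) ∧ AlgebraicGeometry.IsClosedImmersion (ι₀G xbar).left
  /-- PIN — **`G₀ x̄ = A_x̄[𝔭_{c•w}]` AS THE KERNEL OF THE IDEAL `𝔭_{c•w}`, ON `T`-POINTS** (P6b `hker` ∕ ★ (O-J) shape): a `T`-point of `A_x̄` is killed by every `ι(a)`, `a ∈ 𝔭_{c•w}`, iff it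
  factors through `ι₀G` — so `(G₀, β₀)` is «`A_x̄[𝔭_{c•w}]` with `ι`» up to unique isomorphism; the K∕BT chain identifies it with the `[ϖ]`-layer of the `c•w`-block at ED. 4 (GEN՚s row),
  nothing of that chain enters this TYPE. [cite: Tate1997FiniteFlatGroupSchemes, (3.7)] [cite: Liu2021, p. 137] -/
  hkerG₀ : ∀ xbar ⦃T : SchemeOver (geomResidueField w)⦄ (t : T ⟶ (sch₀Of 𝓜 w 𝒜 xbar).X),
    (∀ a ∈ ((IsCMField.complexConj F) • w).asIdeal, t ≫ (act₀Of 𝓜 w 𝒜 ρ a xbar).hom.hom.hom = 1) ↔ ∃ s : T ⟶ G₀ xbar, s ≫ ι₀G xbar = t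
  /-- PIN — `β₀` is the restriction of `ι`: `β₀(a) ≫ ι₀G = ι₀G ≫ ι(a)_x̄`. [cite: Kottwitz1992, §5, p. 390] -/
  hβ₀G : ∀ xbar a, β₀ xbar a ≫ ι₀G xbar = ι₀G xbar ≫ (act₀Of 𝓜 w 𝒜 ρ a xbar).hom.hom.hom
  /-- K-DATA — the UNIT COMPONENT `U x̄ = (G₀ x̄)⁰` (P6c binder `U`; ★ (b1a) `exists_unitComponent`). [cite: Tate1997FiniteFlatGroupSchemes, (3.7)] -/
  U₀ : AlgPoints (𝓜.localise w).reductionAt (geomResidueField w) → SchemeOver (geomResidueField w)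
  /-- its group structure (P6c binder `[∀ x, GrpObj (U x)]`). [cite: Tate1997FiniteFlatGroupSchemes, (3.7)] -/
  grpU₀ : ∀ xbar, GrpObj (U₀ xbar)
  /-- affine (P6c binder `[∀ x, IsAffine (U x).left]`). [cite: Tate1997FiniteFlatGroupSchemes, (3.7)] -/
  affU₀ : ∀ xbar, AlgebraicGeometry.IsAffine (U₀ xbar).left
  /-- the inclusion `jU : U x̄ → G₀ x̄` (P6c binder `jU`). [cite: Tate1997FiniteFlatGroupSchemes, (3.7)] -/
  jU₀ : ∀ xbar, U₀ xbar ⟶ G₀ xbar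
  /-- `jU` is a homomorphism, an open and closed immersion, with connected source — it IS the unit component (P6c binder `hU`). [cite: Tate1997FiniteFlatGroupSchemes, (3.7)] -/
  hU₀ : ∀ xbar, (letI := grp₀ xbar; letI := grpU₀ xbar; IsMonHom (jU₀ xbar)) ∧ AlgebraicGeometry.IsOpenImmersion (jU₀ xbar).left ∧
    AlgebraicGeometry.IsClosedImmersion (jU₀ xbar).left ∧ ConnectedSpace ↥(U₀ xbar).left
  /-- the Frobenius height exponent of the unit component (P6c binder `NU`; P6b N1). [cite: Tate1997FiniteFlatGroupSchemes, (3.7)] -/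
  NU₀ : AlgPoints (𝓜.localise w).reductionAt (geomResidueField w) → ℕ
  /-- MONOGENIC COORDINATE `κ̄[X]∕(X^{p^{NU}}) ≃ Γ(U x̄)` (P6c binder `θU`; P6b `blockNumerics_of_line` output, here GEN՚s obligation). [cite: Tate1997FiniteFlatGroupSchemes, (3.7)] -/
  θU₀ : ∀ xbar, ((geomResidueField w)[X] ⧸ Ideal.span {(Polynomial.X : (geomResidueField w)[X]) ^ (pChar ^ NU₀ xbar)}) ≃ₐ[geomResidueField w] Alg (U₀ xbar)
  /-- K-HYP — `F_q²` kills the unit component (P6c binder `hFFU`; ordinary: `F_q` already; supersingular: local–local of `𝒪`-height 2). [cite: Liu2021, p. 137] -/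
  hFFU₀ : ∀ xbar, letI := grp₀ xbar; letI := grpU₀ xbar;
    jU₀ xbar ≫ relFrobeniusOver pChar fDeg (G₀ xbar) ≫ relFrobeniusOver pChar fDeg (frobeniusTwistOver pChar fDeg (G₀ xbar)) = 1
  /-- K-HYP — RANK `q²`: `G₀ x̄` has order `q² = N(c•w)²` (the `[ϖ]`-layer of a `c•w`-block of `𝒪_{c•w}`-height 2; Kottwitz signature for `n = 2`) (P6c `hrkG`). [cite: Liu2021, p. 137] [cite: RapoportSmithlingZhang2020Diagonal, §4.1 p. 17] -/
  hrkG₀ : ∀ xbar, haveI := aff₀ xbar; Module.finrank (geomResidueField w) (Alg (G₀ xbar)) = pChar ^ fDeg * pChar ^ fDeg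
  /-- K-HYP — RANK `q` OF THE FROBENIUS QUOTIENT: `Ker(F_q | G₀ x̄)` has order `q` (the block is 1-DIMENSIONAL — the Kottwitz signature; P6c `hrkF`). [cite: Liu2021, p. 137] [cite: RapoportSmithlingZhang2020Diagonal, §4.1 p. 17] -/
  hrkF₀ : ∀ xbar, letI := grp₀ xbar; haveI := aff₀ xbar; Module.finrank (geomResidueField w) (Alg (G₀ xbar) ⧸ kerFI pChar fDeg (G₀ xbar)) = pChar ^ fDeg
  /-- K-HYP — `#G₀ x̄(κ̄) ∈ {1, q}` (supersingular ∕ ordinary; P6c `hpts`). [cite: Liu2021, p. 137] -/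
  hpts₀ : ∀ xbar, letI := grp₀ xbar;
    Nat.card (𝟙_ (SchemeOver (geomResidueField w)) ⟶ G₀ xbar) = 1 ∨ Nat.card (𝟙_ (SchemeOver (geomResidueField w)) ⟶ G₀ xbar) = pChar ^ fDeg
  /-- K-HYP — the `𝒪_F`-stable subgroups of `G₀ x̄(κ̄)` are `⊥` and `⊤` (a `κ(c•w)`-line; P6c `hsimple`). [cite: Liu2021, p. 137] -/
  hsimple₀ : ∀ xbar, letI := grp₀ xbar;
    ∀ Λ : Subgroup (𝟙_ (SchemeOver (geomResidueField w)) ⟶ G₀ xbar), (∀ a, ∀ g ∈ Λ, g ≫ β₀ xbar a ∈ Λ) → Λ = ⊥ ∨ Λ = ⊤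
  /-- **D-4 DOWNSTAIRS IDENTIFICATION — `Sub x̄ ≃` the ADMISSIBLE IDEALS of `G₀ x̄` of corank `q`** (P6c binder `subEquiv`; ref1 J10: makes `Sub` honest). [cite: Tate1997FiniteFlatGroupSchemes, (3.7)] -/
  subEquiv : ∀ xbar, letI := grp₀ xbar; haveI := aff₀ xbar; Sub xbar ≃ AdmSub (G₀ xbar) (β₀ xbar) (pChar ^ fDeg)
  /-- **`kerF x̄` IS THE FROBENIUS KERNEL** — its ideal is `kerFI p f (G₀ x̄)` (P6c binder `hkerF`; ref1 J10: kills the mutation `kerF := étale position` that made HFROB false as typed in v0.4b).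
  [cite: SGA3I, VII_A 4.1] [cite: Liu2021, p. 137] -/
  kerF_spec : ∀ xbar, letI := grp₀ xbar; haveI := aff₀ xbar; (subEquiv xbar (kerF xbar)).1 = kerFI pChar fDeg (G₀ xbar)
  /-- **`IsEtale H` IS ÉTALENESS of the subgroup scheme `H` cuts out** (P6c binder `hIsEtale`). [cite: Tate1997FiniteFlatGroupSchemes, (3.7)] -/
  isEtale_spec : ∀ xbar (H : Sub xbar), IsEtale H ↔ (letI := grp₀ xbar; haveI := aff₀ xbar; IdealIsEtale (G₀ xbar) (subEquiv xbar H).1)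
  /-- K-DATA — the `[ϖ]`-LAYER MAP of the quotient isogeny `A_x̄ → A_{quot x̄ H}` on the `c•w`-layers (P6c binder `isogW`). [cite: Liu2021, Prop. D.8 p. 135, p. 137] -/
  isogW₀ : ∀ xbar (H : Sub xbar), G₀ xbar ⟶ G₀ (quot xbar H)
  /-- a homomorphism (P6c binder `hisogHom`). [cite: Liu2021, p. 137] -/
  isogW₀_hom : ∀ xbar (H : Sub xbar), letI := grp₀ xbar; letI := grp₀ (quot xbar H); IsMonHom (isogW₀ xbar H)
  /-- it KILLS `H` (P6c binder `hisogKer`, ideal currency through `subEquiv`). [cite: Liu2021, p. 137] -/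
  isogW₀_ker : ∀ xbar (H : Sub xbar), letI := grp₀ xbar; haveI := aff₀ xbar; letI := grp₀ (quot xbar H);
    quotIncl (G₀ xbar) (subEquiv xbar H).1 ≫ isogW₀ xbar H = 1
  /-- **D6 IN KILLS-FORM** — the second quotient through a subgroup killed by the layer map is the central translate: `quot (quot x̄ H) H′ = transl x̄` (P6c binder `hD6`; Liu՚s `T∘T ⊇ ⟨ϖ⟩`,
  `t₁² = t_{ϖ²,1} + (q+1)t₂`). [cite: Liu2021, Prop. D.8 (2) p. 135, p. 137] -/
  quot_quot₀ : ∀ xbar (H : Sub xbar) (H' : Sub (quot xbar H)),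
    (letI := grp₀ (quot xbar H); haveI := aff₀ (quot xbar H);
      (subEquiv (quot xbar H) H').1 ≤ (RingHom.ker (isogW₀ xbar H).left.appTop.hom : Ideal (Alg (G₀ (quot xbar H))))) →
      quot (quot xbar H) H' = transl xbar
  /-- **(b4′) THE CANONICAL LINE** — over an ORDINARY reduction exactly one line specialises to `ker F` (P6c binder `hKb4`; ★ (E-b4′) `CanonicalLine.existsUnique_admK_spI_eq_kerFI`, ★ p845304).
  [cite: Liu2021, p. 137] [cite: Carayol1986Compositio, §10.3 Prop. p. 211] -/
  canonicalLine₀ : ∀ y, (∃ H : Sub (red₀Of S Kc 𝓜 w h𝓨 e y), IsEtale H) →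
    ∃ L₀ : Line y, sp y L₀ = kerF (red₀Of S Kc 𝓜 w h𝓨 e y) ∧ ∀ L : Line y, sp y L = kerF (red₀Of S Kc 𝓜 w h𝓨 e y) → L = L₀

set_option maxHeartbeats 400000 in
/-- (R-2) **`FrobReading₀` — THE DOWNSTAIRS FROBENIUS READINGS OF THE DATUM** (LEAD M-17j (2) «(R-2) belongs IN ED. 3»; ref1 (g2) J10; the three kernel laws AT ONCE through (rL)): for the
universal tuple of a `ModuliDatum`, its carriers `Line ∕ Sub ∕ kerF ∕ quotΩ ∕ sp` and its twist reading (`twistIdeal`, `twistNorm`): the Frobenius co-ideal `𝔠` with `𝔠𝔭_w = 𝔞_γ`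
(`frobIdeal`, `frobIdeal_spec`), the DOWNSTAIRS ROOF of the canonical translate carrying the FROBENIUS-KERNEL LAW (`quot₀_roof : Roof₀ …`, (rL) = ★ σ2-CORE `hker`), and the FROBENIUS
COVER of the reduction of `σ • y` (`frob₀_cover : FrobCover₀ …`).  Packaged as ONE structure-valued field `ModuliDatum.frob₀`.  DERIVATION OF HFROB (card J10 row): `frob₀_cover` gives
`A_{red₀(σ•y)} ≅ A_x̄^{(q)} ⊗ 𝔞_γ`; ★ σ2-CORE + (rL) + (r2₀) give `A_x̄^{(q)} ≅ B̄ ⊗ 𝔠⁻¹·(q)…`, i.e. `A_x̄^{(q)} ⊗ 𝔞_γ ≅ A_x̄″` — EXACT on `λ` by ★ σ2-CORE-λ (`FrobeniusVersusHeckeSerreTensorPolarization`)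
∕ ★ `RelFrobeniusPolarizedRecognition` ∕ ★ `SerreTranslateComposition` (π₀-free), on `ι` by (r4₀)(f4), on level by (r5₀)(f5); then `inj₀` ⇒ `red₀ (quotΩ y L) = red₀ (σ • y)`.
[cite: Liu2021, Prop. D.8 (3) p. 135, pp. 136–138] [cite: Shimura1998, §13.1 Thm. 1 (pp. 97–99)] [cite: RapoportSmithlingZhang2020Diagonal, §4.3 (4.23) p. 21] [cite: Kottwitz1992, §5, p. 391] -/
structure FrobReading₀ {F : Type} [Field F] [NumberField F] [IsCMField F] {ι₁ : F →+* ℂ} {Jstar : Matrix (Fin 2) (Fin 2) F}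
    {K₀ : C5.OpenCompactSubgroup ↥(finAdelic ↥(maximalRealSubfield F) F (IsCMField.complexConj F) 2 Jstar)}
    (S : RecordSystemGS F Jstar ι₁ K₀) {Fi : Type} [Field Fi] [Algebra F Fi] (Kc : C5.SmallLevel K₀)
    (𝓜 : IntegralModel (𝓞 F) F ((thickening F Fi).obj (S.M.obj Kc))) (w : HeightOneSpectrum (𝓞 F))
    (h𝓨 : (𝓜.localise w).IsSmoothProper 1) (e : Fi →ₐ[F] AlgebraicClosure (w.adicCompletion F))
    (𝒜 : Literature.AlgebraicGeometry.AbelianSchemes.AbelianSchemeOver (𝓜.localise w).total.left)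
    (ρ : Literature.AlgebraicGeometry.AbelianSchemes.AbelianSchemeOver.RingAction (𝓞 F) 𝒜)
    (D : 𝒜.DualPair) (pol : 𝒜.Polarization D) {g N : ℕ} (lvl : 𝒜.LevelStructure g N)
    (pChar fDeg : ℕ) [ExpChar (geomResidueField w) pChar]
    (Line : AlgPoints (S.M.obj Kc) (AlgebraicClosure (w.adicCompletion F)) → Type)
    (Sub : AlgPoints (𝓜.localise w).reductionAt (geomResidueField w) → Type) (kerF : ∀ xbar, Sub xbar)
    (quotΩ : ∀ y, Line y → AlgPoints (S.M.obj Kc) (AlgebraicClosure (w.adicCompletion F)))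
    (sp : ∀ y, Line y → Sub (red₀Of S Kc 𝓜 w h𝓨 e y))
    (twistIdeal : (Fi ≃ₐ[F] Fi) → Ideal (𝓞 F)) (twistNorm : (Fi ≃ₐ[F] Fi) → ℕ) where
  /-- **THE FROBENIUS CO-IDEALS `𝔠(γ) = 𝔞_γ 𝔭_w⁻¹ = 𝔭_w^{d_w−1}·𝔟_γ`**, INDEXED by the automorphism `γ` reading a Frobenius on the sheet (LEAD M-17p (p-i): two arithmetic Frobenius
  elements reading `e` through different `γ` — different decomposition groups, inertia — may have different `𝔞_γ = twistIdeal γ`; data, pinned by `frobIdeal_spec`; ★ σ2-CORE՚s `𝔠`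
  with `𝔭𝔠 = (π₀)`). [cite: Shimura1998, §13.1 Thm. 1 (pp. 97–99)] -/
  frobIdeal : (Fi ≃ₐ[F] Fi) → Ideal (𝓞 F)
  /-- `𝔠(γ) · 𝔭_w = 𝔞_γ` for every `γ` reading an arithmetic Frobenius `σ` on the sheet `e` (in print `𝔞_γ = 𝔭_w^{d_w}𝔟_γ`, `𝔟_γ` prime to `w`, `c•w`, so `𝔠(γ) = 𝔭_w^{d_w−1}𝔟_γ`, integral; GEN-internal since v0.5). [cite: Shimura1998, §13.1 Thm. 1 (pp. 97–99)] -/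
  frobIdeal_spec : ∀ (σ : Field.absoluteGaloisGroup (w.adicCompletion F)), IsAbsArithFrob σ → ∀ γ : Fi ≃ₐ[F] Fi,
    ((AlgEquiv.restrictScalars F (Field.absoluteGaloisGroup.toAlgEquiv (w.adicCompletion F) σ) :
        AlgebraicClosure (w.adicCompletion F) ≃ₐ[F] AlgebraicClosure (w.adicCompletion F)) :
        AlgebraicClosure (w.adicCompletion F) →ₐ[F] AlgebraicClosure (w.adicCompletion F)).comp e = e.comp (γ : Fi →ₐ[F] Fi) →
    frobIdeal γ * w.asIdeal = twistIdeal γ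
  /-- **`n_γ = q`** — the norm number of the twist ideal of a `γ` READING AN ARITHMETIC FROBENIUS `σ` on the sheet `e` is `q = p^{f_w}` (`𝔞_γ𝔞̄_γ = (N w)`: Shimura–Taniyama for a
  Frobenius of `F_w`; LEAD M-17p «state which field pins `n_γ = q`» — THIS ONE, so that the `λ`-scalars of `frob₀_cover` (f3) (`n_γ`) and of the σ2 spine (`F^*λ^{(q)} = q·λ`, ★ (DF)) match
  EXACTLY and σ1∕σ2 never re-derive it; in print `(n_γ) = 𝔞_γ𝔞̄_γ = (q)`). [cite: Shimura1998, §13.1 Thm. 1 (pp. 97–99); §18.6 p. 127] -/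
  twistNorm_eq : ∀ (σ : Field.absoluteGaloisGroup (w.adicCompletion F)), IsAbsArithFrob σ → ∀ γ : Fi ≃ₐ[F] Fi,
    ((AlgEquiv.restrictScalars F (Field.absoluteGaloisGroup.toAlgEquiv (w.adicCompletion F) σ) :
        AlgebraicClosure (w.adicCompletion F) ≃ₐ[F] AlgebraicClosure (w.adicCompletion F)) :
        AlgebraicClosure (w.adicCompletion F) →ₐ[F] AlgebraicClosure (w.adicCompletion F)).comp e = e.comp (γ : Fi →ₐ[F] Fi) →
    twistNorm γ = pChar ^ fDeg
  /-- **D8∕(R-2) THE DOWNSTAIRS ROOF OF THE CANONICAL TRANSLATE WITH THE FROBENIUS-KERNEL LAW** (helper `Roof₀`, (rL) = ★ σ2-CORE `hker`): for a line `L` at `y` specialising to `ker F`, the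
  special tuples at `red₀ y` and `red₀ (quotΩ y L)` are joined by a roof `A_x̄ —q̄→ B̄ ←c̄— A_x̄″` (`Ker c̄ = A_x̄″[𝔭_w]`, `λ` EXACT with factor `p`, level) AND `Ker F_q(A_x̄) = q̄⁻¹(B̄[𝔠(γ)])`, INDEXED
  like `frob₀_cover` by the `γ` reading an arithmetic Frobenius `σ` on `e` (LEAD M-17p (p-i); the roof itself does not depend on `γ`, its law (rL) reads `𝔠(γ)`).  Truth for
  the witness: the reduction of the generic roof (helper `RoofΩ` through `H_L ⊕ N`, GEN-side) along the integral points (organs (S-c) «homs of generic fibres extend» + (d5)(d6) + Serre BC ★ p846354) and the CONGRUENCE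
  RELATION for (rL) (block laws: `c•w` by hypothesis, `w` by Cartier duality and heights, banal by Shimura–Taniyama).  Why it might fail: only through an orientation slip upstream (J-rows «D4
  ORIENTATION», «TWIST ORIENTATION») — (rL) is then false on the `w`-block by an order count (card J9). [cite: Liu2021, Prop. D.8 (3) p. 135, pp. 136–138] [cite: RapoportSmithlingZhang2020Diagonal, §4.3 (4.23) p. 21]
  [cite: Kottwitz1992, §5, p. 391] -/
  quot₀_roof : ∀ (σ : Field.absoluteGaloisGroup (w.adicCompletion F)), IsAbsArithFrob σ → ∀ γ : Fi ≃ₐ[F] Fi,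
    ((AlgEquiv.restrictScalars F (Field.absoluteGaloisGroup.toAlgEquiv (w.adicCompletion F) σ) :
        AlgebraicClosure (w.adicCompletion F) ≃ₐ[F] AlgebraicClosure (w.adicCompletion F)) :
        AlgebraicClosure (w.adicCompletion F) →ₐ[F] AlgebraicClosure (w.adicCompletion F)).comp e = e.comp (γ : Fi →ₐ[F] Fi) →
    ∀ y (L : Line y), sp y L = kerF (red₀Of S Kc 𝓜 w h𝓨 e y) →
      Roof₀ 𝓜 w 𝒜 ρ D pol lvl pChar fDeg w.asIdeal (frobIdeal γ) (red₀Of S Kc 𝓜 w h𝓨 e y) (red₀Of S Kc 𝓜 w h𝓨 e (quotΩ y L))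
  /-- **THE FROBENIUS COVER OF THE REDUCTION OF `σ • y`** (helper `FrobCover₀`): for an arithmetic Frobenius `σ` read by `γ` on the sheet `e`, `𝒯₀(red₀(σ • y)) ≅ 𝒯₀(red₀ y)^{(q)} ⊗ 𝔞_γ` EXACTLY, with
  norm `n_γ := twistNorm γ` — PINNED TO `q = p^{fDeg}` by the field `twistNorm_eq` above (LEAD M-17p), in ℕ — and level `c̄(σ^a) = F_q(σ^a)`.  Truth for the witness: reduction of `twistΩ.cover γ (σ • y)` along `ℓ_{e∘γ}(σ•y) = σ(ℓ_e y)` and «reduction of the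
  `σ`-conjugate = Frobenius twist of the reduction».  Why it might fail: cover orientation (J-row «TWIST ORIENTATION») — then (f3)՚s scalar would be `n_γ⁻¹`, untypeable.
  [cite: Shimura1998, §13.1 Thm. 1 (pp. 97–99); §18.6 p. 127] [cite: SerreTate1968, Thm 1, Cor. 2] [cite: RapoportSmithlingZhang2020Diagonal, §3.2 p. 11] -/
  frob₀_cover : ∀ (σ : Field.absoluteGaloisGroup (w.adicCompletion F)), IsAbsArithFrob σ → ∀ γ : Fi ≃ₐ[F] Fi,
    ((AlgEquiv.restrictScalars F (Field.absoluteGaloisGroup.toAlgEquiv (w.adicCompletion F) σ) :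
        AlgebraicClosure (w.adicCompletion F) ≃ₐ[F] AlgebraicClosure (w.adicCompletion F)) :
        AlgebraicClosure (w.adicCompletion F) →ₐ[F] AlgebraicClosure (w.adicCompletion F)).comp e = e.comp (γ : Fi →ₐ[F] Fi) →
    ∀ y : AlgPoints (S.M.obj Kc) (AlgebraicClosure (w.adicCompletion F)),
      FrobCover₀ 𝓜 w 𝒜 ρ D pol lvl pChar fDeg (twistIdeal γ) (twistNorm γ) (red₀Of S Kc 𝓜 w h𝓨 e (σ • y)) (red₀Of S Kc 𝓜 w h𝓨 e y)


end Summit.HodgeConjecture.HodgeConjecture.Cruxes.HLiu418.F0P6aModuliDatumDefs
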